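import Literature.NumberTheory.EllipticCurves.LangHeightArchEstimateProofs
import Literature.NumberTheory.EllipticCurves.KleinJCuspExpansion
import Mathlib.Analysis.Complex.ExponentialBounds
import Mathlib.Analysis.Real.Pi.Bounds
import HarnessLib

/-!
# Hindry–Silverman's Lemma 5, proved: `λ(r₁ + r₂τ) ≥ (1/288) max{1, log|j(τ)|}` near the origin

Topic `NumberTheory/EllipticCurves` (family `abc`, G06). Pure proofs (theorems only). This file
**discharges** the named fact `Literature.NumberTheory.EllipticCurves.Petsche2006_lemma5`
(`LangHeightArchEstimate.lean`; Petsche, New York J. Math. 12 (2006), Lemma 5 = Hindry–Silverman,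
Invent. Math. 93 (1988), Prop. 2.3 / C. R. Acad. Sci. 329 (1999), Lemme 1):

> for `τ` in the standard fundamental domain `𝒟`, `z = r₁ + r₂τ ≠ 0` with
> `max{|r₁|, |r₂|} ≤ 1/24`: `λ(z) ≥ (1/288) max{1, log|j(τ)|}`,

where `λ = neronFunction τ` is the Néron function on `ℂ/(ℤτ + ℤ)` in the `q`-expansion form of
Silverman ATAEC Thm. VI.3.4 and `j = kleinJ = E₄³/Δ`. As a consequence the archimedean step of
Petsche's Prop. 7 (`Petsche2006_exists_subset_le_neronLocalHeight_real`) now rests on ATAEC VI.3.4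
alone (`Petsche2006_exists_subset_le_neronLocalHeight_real_of_neronFunction`), and the frontier of
the formal proof of `szpiro_imp_langHeightLowerBoundConjecture` (Hindry–Silverman 1988, Thm. 0.3)
becomes `szpiro_imp_langHeightLowerBoundConjecture_of_uniformisationFacts`: Petsche's Lemma 3
(Tate uniformisation), the Kodaira–Néron facts, and ATAEC VI.3.4 (complex uniformisation of `λ`).

## Proof (Hindry–Silverman's route with crude constants)

Write `t = 2π Im τ`, `q = e^{2πiτ}` (`|q| = e^{−t}`), `u = e^{2πiz}`. On `𝒟`: `Im τ ≥ 0.866`, so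
`t ≥ 5.4` and `|q| ≤ 1/100` (`im_ge_of_mem_fd`, `two_pi_im_ge_of_mem_fd`,
`norm_cexp_le_of_mem_fd`, using Mathlib's `Real.pi_gt_d2`, `Real.exp_one_gt_d9`). By evenness
(`neronFunction_neg`) assume `0 ≤ r₂ ≤ 1/24`. Then in
`λ(z) = ½B₂(r₂)t − log|1 − u| − Σ_{n≥1} log|(1 − qⁿu)(1 − qⁿu⁻¹)|`:

* `B₂(r₂) = r₂² − r₂ + 1/6 ≥ 1/8`, so the first term is `≥ t/16`;
* `|1 − u| ≤ 1` (`norm_one_sub_cexp_le_one`: `|u| ≤ 1` and `Re u ≥ |u|/2` because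
  `|2π Re z| ≤ 2π(1/24 + 1/48) ≤ π/3`), so `−log|1 − u| ≥ 0`;
* `|qⁿu|, |qⁿu⁻¹| ≤ ρⁿ` with `ρ = e^{−23t/24} ≤ e^{−5} < 1/148`, so the series is
  `≤ 3ρ/(1 − ρ) ≤ 1/16` (`tsum_neronFunction_term_le`, summable by `summable_neronFunction_term`);
* `log|j(τ)| ≤ t + 13` (`log_norm_kleinJ_le`: `|E₄| ≤ 49` from `E₄ = 1 + 240Σσ₃(n)qⁿ`,
  `σ₃(n) ≤ 16ⁿ`; `|∏(1 − qⁿ)²⁴| ≥ 1/2`; `Δ = q∏(1 − qⁿ)²⁴`; `2·49³ < e¹³`);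

and `t/16 − 1/16 ≥ (t + 13)/288` since `17t ≥ 31`. (Hindry–Silverman's sharper bookkeeping gives
their constant `1/288 ≈ (1/16)/18` with room to spare; numerically the worst ratio
`λ/bound` over `𝒟 × [−1/24, 1/24]²` is about `18`.)

## References

* C. Petsche, New York J. Math. 12 (2006), 257–268 (arXiv math/0508160), Lemma 5.
* M. Hindry, J. H. Silverman, Invent. Math. 93 (1988), 419–450, §2, Prop. 2.3; C. R. Acad. Sci.
  Paris Sér. I 329 (1999), 97–100, Lemme 1.
* J. H. Silverman, *Advanced Topics in the Arithmetic of Elliptic Curves* (1994), Thm. VI.3.4,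
  Prop. I.7.4 (`q`-expansions of `E₄`, `Δ`, `j`).
* J.-P. Serre, *A Course in Arithmetic*, VII §1.2 (the fundamental domain), §4 (`q`-expansions).
-/

noncomputable section

open scoped UpperHalfPlane Modular Real Topology

open Complex Filter

namespace Literature.NumberTheory.EllipticCurves

open Literature.NumberTheory.EllipticCurves.ModularForms ArithmeticFunction

/-- `e⁵ > 148` (from Mathlib's `exp 1 > 2.7182818283`). [folklore] -/
theorem exp_five_gt : (148 : ℝ) < Real.exp 5 := by
  have h := Real.exp_one_gt_d9
  have h5 : Real.exp 5 = Real.exp 1 ^ 5 := by rw [Real.exp_one_pow]; norm_num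
  rw [h5]
  have : (148 : ℝ) < 2.7182818283 ^ 5 := by norm_num
  exact this.trans (pow_lt_pow_left₀ h (by norm_num) (by norm_num))

/-- `e¹³ > 440000` (from Mathlib's `exp 1 > 2.7182818283`). [folklore] -/
theorem exp_thirteen_gt : (440000 : ℝ) < Real.exp 13 := by
  have h := Real.exp_one_gt_d9
  have h13 : Real.exp 13 = Real.exp 1 ^ 13 := by rw [Real.exp_one_pow]; norm_num
  rw [h13]
  have : (440000 : ℝ) < 2.7182818283 ^ 13 := by norm_num
  exact this.trans (pow_lt_pow_left₀ h (by norm_num) (by norm_num))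

/-! #### `E₄` and `Δ` for `|q| ≤ 1/100`; `log|j(τ)| ≤ log|1/q| + 13` -/

/-- **`|E₄(τ)| ≤ 49` for `|q| ≤ 1/100`**: `E₄ = 1 + 240 Σ σ₃(n)qⁿ` (`E₄_eq_tsum`) with
`σ₃(n) ≤ 16ⁿ`, so `|E₄| ≤ 1 + 240 · 16|q|/(1 − 16|q|) ≤ 49`. [folklore] -/
theorem norm_E₄_le_of_norm_qParam_le (τ : ℍ) (hq : ‖Function.Periodic.qParam 1 (τ : ℂ)‖ ≤ 1 / 100) :
    ‖ModularForm.E₄ τ‖ ≤ 49 := by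
  set q := Function.Periodic.qParam 1 (τ : ℂ) with hqdef
  set r := ‖q‖ with hr
  have hr0 : 0 ≤ r := norm_nonneg _
  have h16 : 16 * r < 1 := by linarith
  have h16' : 0 ≤ 16 * r := by linarith
  have hs : Summable fun n : ℕ => (sigma 3 (n + 1) : ℂ) * q ^ (n + 1) :=
    (summable_nat_add_iff (f := fun n : ℕ => (sigma 3 n : ℂ) * q ^ n) 1).mpr
      (summable_sigma_mul_qParam_pow τ)
  have hg : Summable fun n : ℕ => (16 * r) ^ (n + 1) :=
    (summable_nat_add_iff (f := fun n : ℕ => (16 * r) ^ n) 1).mpr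
      (summable_geometric_of_lt_one h16' h16)
  have hterm : ∀ n : ℕ, ‖(sigma 3 (n + 1) : ℂ) * q ^ (n + 1)‖ ≤ (16 * r) ^ (n + 1) := by
    intro n
    rw [norm_mul, norm_pow, ← hr, Complex.norm_natCast, mul_pow]
    exact mul_le_mul_of_nonneg_right (sigma_three_le_sixteen_pow (n + 1)) (pow_nonneg hr0 _)
  have htsum : ‖∑' n : ℕ, (sigma 3 (n + 1) : ℂ) * q ^ (n + 1)‖ ≤ 16 * r / (1 - 16 * r) := by
    calc ‖∑' n : ℕ, (sigma 3 (n + 1) : ℂ) * q ^ (n + 1)‖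
        ≤ ∑' n : ℕ, ‖(sigma 3 (n + 1) : ℂ) * q ^ (n + 1)‖ := norm_tsum_le_tsum_norm hs.norm
      _ ≤ ∑' n : ℕ, (16 * r) ^ (n + 1) := hs.norm.tsum_le_tsum hterm hg
      _ = 16 * r / (1 - 16 * r) := by
          rw [show (fun n : ℕ => (16 * r) ^ (n + 1)) = fun n : ℕ => 16 * r * (16 * r) ^ n from
            funext fun n => pow_succ' _ _, tsum_mul_left, tsum_geometric_of_lt_one h16' h16]
          field_simp
  have hfrac : 16 * r / (1 - 16 * r) ≤ 1 / 5 := by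
    rw [div_le_div_iff₀ (by linarith) (by norm_num)]
    linarith
  rw [E₄_eq_tsum τ]
  calc ‖(1 : ℂ) + 240 * ∑' n : ℕ, (sigma 3 (n + 1) : ℂ) * q ^ (n + 1)‖
      ≤ ‖(1 : ℂ)‖ + ‖(240 : ℂ) * ∑' n : ℕ, (sigma 3 (n + 1) : ℂ) * q ^ (n + 1)‖ := norm_add_le _ _
    _ = 1 + 240 * ‖∑' n : ℕ, (sigma 3 (n + 1) : ℂ) * q ^ (n + 1)‖ := by
        rw [norm_one, norm_mul]; norm_num
    _ ≤ 1 + 240 * (1 / 5) := by linarith [htsum.trans hfrac]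
    _ = 49 := by norm_num

/-- **`|∏_{n≥1} (1 − qⁿ)²⁴| ≥ 1/2` for `|q| ≤ 1/100`**: the product is `exp(24 Σ log(1 − qⁿ))`
(`cexp_tsum_log_one_sub_pow`) and `Re log(1 − qⁿ) = log|1 − qⁿ| ≥ −2|q|ⁿ`, so its modulus is
`≥ exp(−48|q|/(1 − |q|)) ≥ 1/2`. [folklore] -/
theorem half_le_norm_tprod_one_sub_pow {q : ℂ} (hq : ‖q‖ ≤ 1 / 100) :
    1 / 2 ≤ ‖∏' n : ℕ, (1 - q ^ (n + 1)) ^ 24‖ := by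
  set r := ‖q‖ with hr
  have hr0 : 0 ≤ r := norm_nonneg _
  have hq1 : ‖q‖ < 1 := by linarith
  set L := ∑' n : ℕ, Complex.log (1 - q ^ (n + 1)) with hL
  have hsL : Summable fun n : ℕ => Complex.log (1 - q ^ (n + 1)) := summable_log_one_sub_pow hq1
  have hprod : ∏' n : ℕ, (1 - q ^ (n + 1)) ^ 24 = cexp (24 * L) := by
    rw [(ModularForm.multipliable_one_sub_pow hq1).tprod_pow, ← cexp_tsum_log_one_sub_pow hq1,
      ← Complex.exp_nat_mul]
    norm_num [hL]
  -- `Re L ≥ −2 Σ rⁿ⁺¹ ≥ −1/49`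
  have hg : Summable fun n : ℕ => r ^ (n + 1) :=
    (summable_nat_add_iff (f := fun n : ℕ => r ^ n) 1).mpr (summable_geometric_of_lt_one hr0 hq1)
  have hre : L.re = ∑' n : ℕ, Real.log ‖1 - q ^ (n + 1)‖ := by
    rw [hL, Complex.re_tsum hsL]
    simp only [Complex.log_re]
  have hterm : ∀ n : ℕ, -2 * r ^ (n + 1) ≤ Real.log ‖1 - q ^ (n + 1)‖ := by
    intro n
    have hn : ‖q ^ (n + 1)‖ ≤ 1 / 2 := by
      rw [norm_pow]
      exact (pow_le_of_le_one hr0 hq1.le (Nat.succ_ne_zero n)).trans (by linarith)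
    have h := abs_log_norm_one_sub_le hn
    rw [abs_le, norm_pow, ← hr] at h
    linarith [h.1]
  have hsre : Summable fun n : ℕ => Real.log ‖1 - q ^ (n + 1)‖ := by
    have := (Complex.hasSum_re hsL.hasSum).summable
    simpa only [Complex.log_re] using this
  have hLre : -(2 * (r / (1 - r))) ≤ L.re := by
    rw [hre]
    have h1 : ∑' n : ℕ, -2 * r ^ (n + 1) = -(2 * (r / (1 - r))) := by
      rw [tsum_mul_left, show (fun n : ℕ => r ^ (n + 1)) = fun n : ℕ => r * r ^ n from
        funext fun n => pow_succ' _ _, tsum_mul_left, tsum_geometric_of_lt_one hr0 hq1]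
      field_simp
    rw [← h1]
    exact (hg.mul_left (-2)).tsum_le_tsum hterm hsre
  have hfrac : r / (1 - r) ≤ 1 / 98 := by
    rw [div_le_div_iff₀ (by linarith) (by norm_num)]
    linarith
  rw [hprod, norm_exp]
  have h24 : (24 * L).re = 24 * L.re := by simp
  rw [h24]
  calc (1 / 2 : ℝ) ≤ 24 * L.re + 1 := by linarith
    _ ≤ Real.exp (24 * L.re) := Real.add_one_le_exp _

/-- **`log|j(τ)| ≤ log|1/q| + 13` for `|q| ≤ 1/100`** (`q = e^{2πiτ}`): `j = E₄³/Δ`,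
`Δ = q ∏(1 − qⁿ)²⁴` (Mathlib `ModularForm.discriminant_eq_q_prod`), `|E₄| ≤ 49` and
`|∏(1 − qⁿ)²⁴| ≥ 1/2` give `|j(τ)| ≤ 2·49³/|q|`, and `2·49³ = 235298 < e¹³`. A crude form of
`j(τ) = q⁻¹ + 744 + O(q)` (cf. `norm_E₄_cube_div_discriminant_sub_sub_le` in
`KleinJCuspExpansion.lean`, which needs `|q| ≤ 10⁻⁴`), valid on the whole fundamental domain.
[folklore] -/
theorem log_norm_kleinJ_le (τ : ℍ) (hq : ‖Function.Periodic.qParam 1 (τ : ℂ)‖ ≤ 1 / 100) :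
    Real.log ‖kleinJ τ‖ ≤ -Real.log ‖Function.Periodic.qParam 1 (τ : ℂ)‖ + 13 := by
  set q := Function.Periodic.qParam 1 (τ : ℂ) with hqdef
  set r := ‖q‖ with hr
  have hq0 : q ≠ 0 := Function.Periodic.qParam_ne_zero (τ : ℂ)
  have hr0 : 0 < r := norm_pos_iff.mpr hq0
  have hr1 : r ≤ 1 := by linarith
  have hlogr : Real.log r ≤ 0 := Real.log_nonpos hr0.le hr1
  set P := ∏' n : ℕ, (1 - q ^ (n + 1)) ^ 24 with hP
  have hΔ : ModularForm.discriminant τ = q * P := ModularForm.discriminant_eq_q_prod τ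
  have hPge : 1 / 2 ≤ ‖P‖ := half_le_norm_tprod_one_sub_pow hq
  have hE : ‖ModularForm.E₄ τ‖ ≤ 49 := norm_E₄_le_of_norm_qParam_le τ hq
  have hj : ‖kleinJ τ‖ = ‖ModularForm.E₄ τ‖ ^ 3 / (r * ‖P‖) := by
    rw [kleinJ, hΔ, norm_div, norm_pow, norm_mul]
  by_cases h0 : ‖kleinJ τ‖ = 0
  · rw [h0, Real.log_zero]
    linarith
  have hjpos : 0 < ‖kleinJ τ‖ := lt_of_le_of_ne (norm_nonneg _) (Ne.symm h0)
  have hbound : ‖kleinJ τ‖ ≤ 235298 / r := by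
    rw [hj, div_le_div_iff₀ (mul_pos hr0 (by linarith)) hr0]
    have hE3 : ‖ModularForm.E₄ τ‖ ^ 3 ≤ 49 ^ 3 := by
      gcongr
    nlinarith [norm_nonneg (ModularForm.E₄ τ)]
  calc Real.log ‖kleinJ τ‖ ≤ Real.log (235298 / r) := Real.log_le_log hjpos hbound
    _ = Real.log 235298 - Real.log r := by rw [Real.log_div (by norm_num) hr0.ne']
    _ ≤ 13 - Real.log r := by
        have : Real.log 235298 ≤ 13 := by
          rw [Real.log_le_iff_le_exp (by norm_num)]
          linarith [exp_thirteen_gt]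
        linarith
    _ = -Real.log r + 13 := by ring


/-! #### The fundamental domain: `Im τ ≥ 0.866`, `2π Im τ ≥ 5.4`, `|q| ≤ 1/100` -/

/-- `Im τ ≥ 0.866` on the standard fundamental domain (`|τ| ≥ 1`, `|Re τ| ≤ ½` give
`Im τ ≥ √3/2 = 0.8660…`; Serre VII §1.2). [folklore] -/
theorem im_ge_of_mem_fd {τ : ℍ} (hτ : τ ∈ 𝒟) : (0.866 : ℝ) ≤ τ.im := by
  have h1 : 1 ≤ Complex.normSq (τ : ℂ) := hτ.1
  have h2 : |τ.re| ≤ 1 / 2 := hτ.2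
  rw [Complex.normSq_apply, UpperHalfPlane.coe_re, UpperHalfPlane.coe_im] at h1
  have hre : τ.re * τ.re ≤ 1 / 4 := by
    have := abs_le.mp h2
    nlinarith
  have him : 0 < τ.im := τ.im_pos
  nlinarith

/-- `2π Im τ ≥ 5.4` on the fundamental domain (`π > 3.14`, `Im τ ≥ 0.866`). [folklore] -/
theorem two_pi_im_ge_of_mem_fd {τ : ℍ} (hτ : τ ∈ 𝒟) : (5.4 : ℝ) ≤ 2 * π * τ.im := by
  have h := im_ge_of_mem_fd hτ
  have hπ := Real.pi_gt_d2
  nlinarith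

/-- `|q| = e^{−2π Im τ}` for `q = e^{2πiτ}`. [folklore] -/
theorem norm_cexp_two_pi_I_mul_eq (τ : ℍ) : ‖cexp (2 * π * I * τ)‖ = Real.exp (-(2 * π * τ.im)) := by
  have hpos : 0 < ‖cexp (2 * π * I * τ)‖ := norm_pos_iff.mpr (exp_ne_zero _)
  rw [← Real.exp_log hpos, log_norm_cexp_two_pi_I_mul, UpperHalfPlane.coe_im]

/-- `|q| ≤ 1/100` on the fundamental domain (`|q| = e^{−2π Im τ} ≤ e^{−5.4} < e^{−5} < 1/148`).
[folklore] -/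
theorem norm_cexp_le_of_mem_fd {τ : ℍ} (hτ : τ ∈ 𝒟) : ‖cexp (2 * π * I * τ)‖ ≤ 1 / 100 := by
  rw [norm_cexp_two_pi_I_mul_eq]
  have ht := two_pi_im_ge_of_mem_fd hτ
  have h5 := exp_five_gt
  calc Real.exp (-(2 * π * τ.im)) ≤ Real.exp (-5) := Real.exp_le_exp.mpr (by linarith)
    _ = (Real.exp 5)⁻¹ := Real.exp_neg 5
    _ ≤ 1 / 100 := by
        rw [inv_le_comm₀ (Real.exp_pos 5) (by norm_num)]
        linarith

/-! #### The three terms of the Néron function near the origin -/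

/-- **`|1 − e^{2πiz}| ≤ 1` when `Im z ≥ 0` and `|Re z| ≤ 1/6`**: with `u = e^{2πiz}`,
`|1 − u|² = 1 − 2 Re u + |u|²`, `|u| = e^{−2π Im z} ≤ 1` and
`Re u = |u| cos(2π Re z) ≥ |u|/2` since `|2π Re z| ≤ π/3`. This is the step "`−log|1 − u| ≥ 0`
near the origin" of Hindry–Silverman's minoration of `λ`. [folklore] -/
theorem norm_one_sub_cexp_le_one {z : ℂ} (him : 0 ≤ z.im) (hre : |z.re| ≤ 1 / 6) :
    ‖1 - cexp (2 * π * I * z)‖ ≤ 1 := by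
  set w : ℂ := 2 * π * I * z with hw
  have hwre : w.re = -(2 * π * z.im) := by simp [hw, mul_comm]
  have hwim : w.im = 2 * π * z.re := by simp [hw, mul_comm]
  set u := cexp w with hu
  have hure : u.re = Real.exp w.re * Real.cos w.im := Complex.exp_re w
  have hun : ‖u‖ = Real.exp w.re := Complex.norm_exp w
  have hexp1 : Real.exp w.re ≤ 1 := by
    rw [hwre, Real.exp_le_one_iff]
    have := Real.pi_pos
    nlinarith
  have hcos : 1 / 2 ≤ Real.cos w.im := by
    rw [← Real.cos_abs, ← Real.cos_pi_div_three]
    apply Real.cos_le_cos_of_nonneg_of_le_pi (abs_nonneg _) (by linarith [Real.pi_pos])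
    rw [hwim, abs_mul, abs_of_pos (by positivity)]
    nlinarith [Real.pi_pos, hre]
  have hsq : ‖1 - u‖ ^ 2 ≤ 1 := by
    have hn2 : ‖u‖ ^ 2 = u.re * u.re + u.im * u.im := by rw [Complex.sq_norm, Complex.normSq_apply]
    have key : ‖u‖ ^ 2 ≤ 2 * u.re := by
      rw [hun, hure]
      have hpos : 0 < Real.exp w.re := Real.exp_pos _
      nlinarith
    rw [Complex.sq_norm, Complex.normSq_apply]
    simp only [Complex.sub_re, Complex.one_re, Complex.sub_im, Complex.one_im, zero_sub]
    nlinarith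
  exact (sq_le_one_iff₀ (norm_nonneg _)).mp hsq

/-- `log|(1 − a)(1 − b)| ≤ |a| + |b| + |a||b|` (`log y ≤ y − 1` and
`|(1 − a)(1 − b)| ≤ (1 + |a|)(1 + |b|)`; trivially true when the product vanishes, `log 0 = 0`).
[folklore] -/
theorem log_norm_one_sub_mul_one_sub_le (a b : ℂ) :
    Real.log ‖(1 - a) * (1 - b)‖ ≤ ‖a‖ + ‖b‖ + ‖a‖ * ‖b‖ := by
  have ha := norm_nonneg a
  have hb := norm_nonneg b
  by_cases h0 : ‖(1 - a) * (1 - b)‖ = 0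
  · rw [h0, Real.log_zero]
    positivity
  · have hpos : 0 < ‖(1 - a) * (1 - b)‖ := lt_of_le_of_ne (norm_nonneg _) (Ne.symm h0)
    have h1a : ‖1 - a‖ ≤ 1 + ‖a‖ := by
      have := norm_sub_le (1 : ℂ) a
      rwa [norm_one] at this
    have h1b : ‖1 - b‖ ≤ 1 + ‖b‖ := by
      have := norm_sub_le (1 : ℂ) b
      rwa [norm_one] at this
    have h1 : ‖(1 - a) * (1 - b)‖ ≤ (1 + ‖a‖) * (1 + ‖b‖) := by
      rw [norm_mul]
      exact mul_le_mul h1a h1b (norm_nonneg _) (by linarith)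
    have := Real.log_le_sub_one_of_pos hpos
    nlinarith

/-- **The tail of the Néron function is small near the origin**: for `2π Im τ ≥ 5.4` and
`0 ≤ Im z ≤ Im τ/24` (i.e. `0 ≤ r₂ ≤ 1/24`), `Σ_{n≥1} log|(1 − qⁿu)(1 − qⁿu⁻¹)| ≤ 1/16`: with
`t = 2π Im τ`, `|q| = e^{−t}`, `|u| ≤ 1`, `|u⁻¹| ≤ e^{t/24}`, each of `|qⁿu|`, `|qⁿu⁻¹|` is at most
`ρⁿ`, `ρ = e^{−23t/24} ≤ e^{−5} < 1/148`, so the `n`-th term is `≤ 3ρⁿ`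
(`log_norm_one_sub_mul_one_sub_le`) and the sum is `≤ 3ρ/(1 − ρ) ≤ 1/16`. [folklore] -/
theorem tsum_neronFunction_term_le (τ : ℍ) (z : ℂ) (ht : (5.4 : ℝ) ≤ 2 * π * τ.im)
    (h0 : 0 ≤ z.im) (h1 : z.im ≤ τ.im / 24) :
    ∑' n : ℕ, Real.log ‖(1 - cexp (2 * π * I * τ) ^ (n + 1) * cexp (2 * π * I * z)) *
      (1 - cexp (2 * π * I * τ) ^ (n + 1) * (cexp (2 * π * I * z))⁻¹)‖ ≤ 1 / 16 := by
  set q := cexp (2 * π * I * τ) with hqdef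
  set u := cexp (2 * π * I * z) with hudef
  set t := 2 * π * τ.im with htdef
  have hq : ‖q‖ = Real.exp (-t) := norm_cexp_two_pi_I_mul_eq τ
  have hu : ‖u‖ = Real.exp (-(2 * π * z.im)) := by
    rw [hudef, norm_exp]
    congr 1
    simp [mul_comm]
  have hq0 : 0 ≤ ‖q‖ := norm_nonneg _
  have hu1 : ‖u‖ ≤ 1 := by
    rw [hu, Real.exp_le_one_iff]
    have := Real.pi_pos
    nlinarith
  have hui : ‖u⁻¹‖ ≤ Real.exp (t / 24) := by
    rw [norm_inv, hu, Real.exp_neg, inv_inv, Real.exp_le_exp, htdef]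
    have := Real.pi_pos
    nlinarith
  set ρ := Real.exp (-(23 / 24 * t)) with hρ
  have hρ0 : 0 ≤ ρ := (Real.exp_pos _).le
  have hρ1 : ρ ≤ 1 / 148 := by
    have h5 := exp_five_gt
    calc ρ ≤ Real.exp (-5) := Real.exp_le_exp.mpr (by linarith)
      _ = (Real.exp 5)⁻¹ := Real.exp_neg 5
      _ ≤ 1 / 148 := by
          rw [inv_le_comm₀ (Real.exp_pos 5) (by norm_num)]
          linarith
  have hρle1 : ρ ≤ 1 := by linarith
  have hqρ : ‖q‖ ≤ ρ := by
    rw [hq, hρ, Real.exp_le_exp]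
    have := Real.pi_pos
    have := τ.im_pos
    nlinarith
  have hqe : ‖q‖ * Real.exp (t / 24) = ρ := by
    rw [hq, hρ, ← Real.exp_add]
    congr 1
    ring
  -- termwise bound by `3 ρⁿ⁺¹`
  have hterm : ∀ n : ℕ, Real.log ‖(1 - q ^ (n + 1) * u) * (1 - q ^ (n + 1) * u⁻¹)‖ ≤ 3 * ρ ^ (n + 1) := by
    intro n
    have ha : ‖q ^ (n + 1) * u‖ ≤ ρ ^ (n + 1) := by
      rw [norm_mul, norm_pow]
      calc ‖q‖ ^ (n + 1) * ‖u‖ ≤ ‖q‖ ^ (n + 1) * 1 := by gcongr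
        _ ≤ ρ ^ (n + 1) := by rw [mul_one]; exact pow_le_pow_left₀ hq0 hqρ _
    have hb : ‖q ^ (n + 1) * u⁻¹‖ ≤ ρ ^ (n + 1) := by
      rw [norm_mul, norm_pow]
      calc ‖q‖ ^ (n + 1) * ‖u⁻¹‖ ≤ ‖q‖ ^ (n + 1) * Real.exp (t / 24) := by gcongr
        _ = ‖q‖ ^ n * (‖q‖ * Real.exp (t / 24)) := by ring
        _ ≤ ρ ^ n * ρ := by
            rw [hqe]
            exact mul_le_mul_of_nonneg_right (pow_le_pow_left₀ hq0 hqρ _) hρ0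
        _ = ρ ^ (n + 1) := by ring
    have hρn : ρ ^ (n + 1) ≤ 1 := pow_le_one₀ hρ0 hρle1
    have hρn0 : 0 ≤ ρ ^ (n + 1) := pow_nonneg hρ0 _
    calc Real.log ‖(1 - q ^ (n + 1) * u) * (1 - q ^ (n + 1) * u⁻¹)‖
        ≤ ‖q ^ (n + 1) * u‖ + ‖q ^ (n + 1) * u⁻¹‖ + ‖q ^ (n + 1) * u‖ * ‖q ^ (n + 1) * u⁻¹‖ :=
          log_norm_one_sub_mul_one_sub_le _ _
      _ ≤ ρ ^ (n + 1) + ρ ^ (n + 1) + ρ ^ (n + 1) * ρ ^ (n + 1) := by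
          gcongr
      _ ≤ 3 * ρ ^ (n + 1) := by nlinarith
  have hρlt : ρ < 1 := by linarith
  have hg : Summable fun n : ℕ => 3 * ρ ^ (n + 1) :=
    ((summable_nat_add_iff (f := fun n : ℕ => ρ ^ n) 1).mpr (summable_geometric_of_lt_one hρ0 hρlt)).mul_left 3
  have hsum : ∑' n : ℕ, 3 * ρ ^ (n + 1) = 3 * (ρ / (1 - ρ)) := by
    rw [tsum_mul_left, show (fun n : ℕ => ρ ^ (n + 1)) = fun n : ℕ => ρ * ρ ^ n from
      funext fun n => pow_succ' _ _, tsum_mul_left, tsum_geometric_of_lt_one hρ0 hρlt]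
    field_simp
  calc ∑' n : ℕ, Real.log ‖(1 - q ^ (n + 1) * u) * (1 - q ^ (n + 1) * u⁻¹)‖
      ≤ ∑' n : ℕ, 3 * ρ ^ (n + 1) := (summable_neronFunction_term τ z).tsum_le_tsum hterm hg
    _ = 3 * (ρ / (1 - ρ)) := hsum
    _ ≤ 1 / 16 := by
        rw [div_eq_mul_inv]
        have h1ρ : (1 - ρ)⁻¹ ≤ 2 := by
          rw [inv_le_comm₀ (by linarith) two_pos]
          linarith
        nlinarith [mul_le_mul_of_nonneg_left h1ρ hρ0]

/-! #### Lemma 5 -/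

/-- **Lemma 5 for `r₂ ≥ 0`** (Hindry–Silverman's minoration of `λ` near the origin; Petsche 2006,
Lemma 5 = Hindry–Silverman, Invent. Math. 93 (1988), Prop. 2.3): for `τ ∈ 𝒟`, `|r₁| ≤ 1/24`,
`0 ≤ r₂ ≤ 1/24` and `z = r₁ + r₂τ`, writing `t = 2π Im τ ≥ 5.4`,
`λ(z) = ½B₂(r₂)·t − log|1 − u| − Σ_{n≥1} log|(1 − qⁿu)(1 − qⁿu⁻¹)| ≥ t/16 − 0 − 1/16`
(`B₂(r₂) = r₂² − r₂ + 1/6 ≥ 1/8`; `norm_one_sub_cexp_le_one` as `|Re z| ≤ 1/24 + 1/48 ≤ 1/6`;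
`tsum_neronFunction_term_le`), while `(1/288) max{1, log|j(τ)|} ≤ (t + 13)/288`
(`log_norm_kleinJ_le`, `|q| ≤ 1/100` on `𝒟`); and `(t − 1)/16 ≥ (t + 13)/288` for `t ≥ 31/17`.
The printed hypothesis `z ≠ 0` is not needed for the inequality (at `z = 0` the junk value
`log 0 = 0` only helps). [cite: Petsche2006, Lemma 5] -/
theorem Petsche2006_lemma5_of_nonneg {τ : ℍ} (hτ : τ ∈ 𝒟) {r₁ r₂ : ℝ} (h₁ : |r₁| ≤ 1 / 24)
    (h₂ : 0 ≤ r₂) (h₂' : r₂ ≤ 1 / 24) :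
    1 / 288 * max 1 (Real.log ‖kleinJ τ‖) ≤ neronFunction τ (r₁ + r₂ * (τ : ℂ)) := by
  set z : ℂ := r₁ + r₂ * (τ : ℂ) with hz
  have hzim : z.im = r₂ * τ.im := by simp [hz]
  have hzre : z.re = r₁ + r₂ * τ.re := by simp [hz]
  set t := 2 * π * τ.im with ht
  have ht54 : (5.4 : ℝ) ≤ t := two_pi_im_ge_of_mem_fd hτ
  have hτim := τ.im_pos
  have hlogq : Real.log ‖cexp (2 * π * I * τ)‖ = -t := by
    rw [log_norm_cexp_two_pi_I_mul, UpperHalfPlane.coe_im]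
  -- term 1: `½ B₂(r₂) t ≥ t/16`
  have hB : 1 / 8 ≤ bernoulliTwo (z.im / τ.im) := by
    rw [hzim, mul_div_cancel_right₀ _ hτim.ne', bernoulliTwo]
    nlinarith
  have hterm1 : t / 16 ≤ -(1 / 2 * bernoulliTwo (z.im / τ.im) * Real.log ‖cexp (2 * π * I * τ)‖) := by
    rw [hlogq]
    have : 0 ≤ t := by positivity
    nlinarith
  -- term 2: `−log|1 − u| ≥ 0`
  have hre : |z.re| ≤ 1 / 6 := by
    rw [hzre]
    have hτre : |τ.re| ≤ 1 / 2 := hτ.2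
    calc |r₁ + r₂ * τ.re| ≤ |r₁| + |r₂ * τ.re| := abs_add_le _ _
      _ = |r₁| + r₂ * |τ.re| := by rw [abs_mul, abs_of_nonneg h₂]
      _ ≤ 1 / 24 + 1 / 24 * (1 / 2) := by gcongr
      _ ≤ 1 / 6 := by norm_num
  have hterm2 : Real.log ‖1 - cexp (2 * π * I * z)‖ ≤ 0 :=
    Real.log_nonpos (norm_nonneg _) (norm_one_sub_cexp_le_one (by rw [hzim]; positivity) hre)
  -- term 3
  have hterm3 := tsum_neronFunction_term_le τ z ht54 (by rw [hzim]; positivity)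
    (by rw [hzim]; nlinarith)
  -- the `j`-invariant
  have hq100 : ‖Function.Periodic.qParam 1 (τ : ℂ)‖ ≤ 1 / 100 := by
    rw [qParam_one_eq_cexp]
    exact norm_cexp_le_of_mem_fd hτ
  have hj : Real.log ‖kleinJ τ‖ ≤ t + 13 := by
    have := log_norm_kleinJ_le τ hq100
    rw [qParam_one_eq_cexp, hlogq] at this
    linarith
  have hmax : max 1 (Real.log ‖kleinJ τ‖) ≤ t + 13 := max_le (by linarith) hj
  rw [neronFunction]
  linarith

/-- **Discharge of `Petsche2006_lemma5`** (Petsche 2006, Lemma 5; Hindry–Silverman 1988,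
Prop. 2.3; 1999, Lemme 1): *for a normalized lattice `ℤ + τℤ` (`τ ∈ 𝒟`) and
`z = r₁ + r₂τ ≠ 0` with `max{|r₁|, |r₂|} ≤ 1/24`, `λ(z) ≥ (1/288) max{1, log|j(τ)|}`.* By the
evenness of the Néron function (`neronFunction_neg`) we may assume `r₂ ≥ 0`
(`Petsche2006_lemma5_of_nonneg`). The formal proof follows Hindry–Silverman's route (explicit
minoration of the three terms of the `q`-expansion of `λ`, ATAEC VI.3.4, against the cusp
expansion of `j`) with cruder constants, which the factor-`18` slack in `1/288` absorbs.
[cite: Petsche2006, Lemma 5] -/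
theorem Petsche2006_lemma5_holds : Petsche2006_lemma5 := by
  intro τ hτ r₁ r₂ hmax _
  have h₁ : |r₁| ≤ 1 / 24 := (le_max_left _ _).trans hmax
  have h₂ : |r₂| ≤ 1 / 24 := (le_max_right _ _).trans hmax
  rcases le_or_gt 0 r₂ with hr₂ | hr₂
  · exact Petsche2006_lemma5_of_nonneg hτ h₁ hr₂ ((le_abs_self _).trans h₂)
  · have h := Petsche2006_lemma5_of_nonneg hτ (r₁ := -r₁) (r₂ := -r₂) (by rwa [abs_neg])
      (by linarith) (by rw [abs_of_neg hr₂] at h₂; exact h₂)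
    have e : ((-r₁ : ℝ) : ℂ) + ((-r₂ : ℝ) : ℂ) * (τ : ℂ) = -((r₁ : ℂ) + r₂ * (τ : ℂ)) := by
      push_cast
      ring
    rwa [e, neronFunction_neg] at h


/-! ### Consequences: the archimedean step from ATAEC VI.3.4 alone; the new frontier -/

/-- **Petsche's archimedean step from ATAEC VI.3.4 alone**: the named fact
`Petsche2006_exists_subset_le_neronLocalHeight_real` follows from `neronLocalHeight_eq_neronFunction`
(Lemma 5 being proved, `Petsche2006_lemma5_holds`). [cite: Petsche2006, proof of Prop. 7] -/
theorem Petsche2006_exists_subset_le_neronLocalHeight_real_of_neronFunction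
    (hU : neronLocalHeight_eq_neronFunction) :
    Petsche2006_exists_subset_le_neronLocalHeight_real :=
  Petsche2006_exists_subset_le_neronLocalHeight_real_of hU Petsche2006_lemma5_holds

open IsDedekindDomain in
/-- **Szpiro ⇒ Lang's height lower bound over `ℚ`, conditional on three uniformisation facts**
(`szpiro_imp_langHeightLowerBoundConjecture`; Hindry–Silverman 1988, Thm. 0.3): Petsche's
Lemma 3 (`h3`, Tate's `p`-adic uniformisation), the Kodaira–Néron facts of `KodairaNeron.lean` at
the local minimal models (`h4`, `hsplit`), and ATAEC Thm. VI.3.4 (`hU`, the local height on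
`E(ℂ) ≅ ℂ/(ℤτ + ℤ)` is the Néron function). Hindry–Silverman's Lemma 5 is no longer a hypothesis.
[cite: HindrySilverman1988, Thm 0.3] -/
theorem szpiro_imp_langHeightLowerBoundConjecture_of_uniformisationFacts
    (h3 : Petsche2006_lemma3)
    (h4 : ∀ (W : WeierstrassCurve ℚ) (v : HeightOneSpectrum ℤ),
      (W.localMinimalModel v).index_goodReductionSubgroup_le_four (v.adicCompletionIntegers ℚ))
    (hsplit : ∀ (W : WeierstrassCurve ℚ) (v : HeightOneSpectrum ℤ),
      (W.localMinimalModel v).index_goodReductionSubgroup_of_hasSplitMultiplicativeReduction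
        (v.adicCompletionIntegers ℚ))
    (hU : neronLocalHeight_eq_neronFunction) :
    szpiro_imp_langHeightLowerBoundConjecture :=
  szpiro_imp_langHeightLowerBoundConjecture_of_localHeightFacts h3 h4 hsplit hU
    Petsche2006_lemma5_holds

open IsDedekindDomain in
/-- **Petsche 2006, Prop. 7 over `ℚ`, conditional on the same three uniformisation facts.**
[cite: Petsche2006, Prop. 7] -/
theorem Petsche2006_card_smallPoints_le_of_uniformisationFacts
    (h3 : Petsche2006_lemma3)
    (h4 : ∀ (W : WeierstrassCurve ℚ) (v : HeightOneSpectrum ℤ),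
      (W.localMinimalModel v).index_goodReductionSubgroup_le_four (v.adicCompletionIntegers ℚ))
    (hsplit : ∀ (W : WeierstrassCurve ℚ) (v : HeightOneSpectrum ℤ),
      (W.localMinimalModel v).index_goodReductionSubgroup_of_hasSplitMultiplicativeReduction
        (v.adicCompletionIntegers ℚ))
    (hU : neronLocalHeight_eq_neronFunction) :
    Petsche2006_card_smallPoints_le :=
  Petsche2006_card_smallPoints_le_of_localHeightFacts h3 h4 hsplit hU Petsche2006_lemma5_holds

end Literature.NumberTheory.EllipticCurves

end
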